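import Summits.BirchSwinnertonDyer.BirchSwinnertonDyer.Theorems.GenusKolyvaginAtTwoTorsionCellD0NegPrimeTwistClasses
import HarnessLib

/-!
# D0≤2, the first genus step: `#Sel⁽²⁾(E₀^{(−p₀)}/ℚ) = 8`

Crux R″ `RankOneTwoTorsionResidualAtTwo` (stmt-27478), LINE 49 «full_vertex», stub D0≤2
`FullTorsionGenusSelmerLawUpToTwoAtTwo`, slice `Q₀ = ∅` (`C₁ = E₀^{(−p₀)}`): for a base `E` with rational `2`-torsion
`e₁ < e₂, e₃`, Mordell–Weil rank `0`, `Ш(E)[2] = 0`, a finite set `S ∋ 2` of primes supporting the conductor and the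
root differences, and a prime `p ∉ S`, `p ≡ 7 (mod 8)`, with `(−p/ℓ) = 1` for every odd `ℓ ∈ S` (every `ℓ ∣ 2N`
split in `ℚ(√−p)`), the `2`-Selmer group of the twist `E^{(−p)}` has EXACTLY `8` elements
(`natCard_selmerGroup_twist_negPrime_eq_eight`) — i.e. `dim Sel₂ = 3 = dim E^{(−p)}[2](ℚ) + 1`, the generic value
at analytic rank one. Proof (LEAD memo `D0le2_memo.md` §2(c), evidence #48 on 27478; the complete `2`-descent of
Silverman X.1.4 / X.4.9 on the tree's cohomological `Sel⁽²⁾`):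

* the parity-pair character at `p` is ONTO `(ℤ/2)²` (the torsion classes `κ(T₁)`, `κ(T₂)` of the twist have parities
  `(0,1)`, `(1,0)` at the twisting prime), so `#Sel⁽²⁾(E^{(−p)}) = 4 · #N_p` (`TwoDescentSelmerBookkeeping`);
* the `p`-unramified part `N_p` is in bijection with the Selmer classes of `E` with positive `T₂`-component
  (`…D0NegPrimeTwistClasses`: transfer at the places of `S` where `−p` is a local square, units elsewhere, signs from
  (R2)), of which there are exactly `2` (`#Sel⁽²⁾(E) = 4`, sign character onto `ℤ/2`).

Everything is proved; no LINE 49 statement is restated; BSD is not advanced by this file alone.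

## References

* [SilvermanAEC2009] J. H. Silverman, *The Arithmetic of Elliptic Curves*, 2nd ed., GTM 106, Springer 2009,
  Prop. X.1.4, Thm. X.4.2, Prop. X.4.9.
* [Kramer1981] K. Kramer, *Arithmetic of elliptic curves upon quadratic extension*, Trans. AMS 264 (1981), Thm. 1.
* [ShuZhai2021] J. Shu, S. Zhai, arXiv:2102.11808, Thm. 1.4 (ii).
-/

noncomputable section

open scoped Classical

namespace Summit.BirchSwinnertonDyer.BirchSwinnertonDyer.Theorems.GenusKolyvaginAtTwo.TorsionCellD0

open WeierstrassCurve WeierstrassCurve.Affine WeierstrassCurve.Affine.Point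
open Literature.NumberTheory.GaloisRepresentations Literature.NumberTheory.EllipticCurves Field
open Literature.NumberTheory.EllipticCurves.TwoDescentLocal
open Literature.NumberTheory.EllipticCurves.KramerTwoDescent
open IsDedekindDomain NumberField Rat.HeightOneSpectrum

variable (E : WeierstrassCurve ℚ) [E.IsElliptic] {e₁ e₂ e₃ : ℚ} (h : E.toAffine.SplitTwoTorsion e₁ e₂ e₃)
variable (S : Finset ℕ) {p : ℕ} [hp : Fact p.Prime]

/-- **The parity-pair character of `Sel⁽²⁾(E^{(−p)})` at `p` is onto**: `#Sel⁽²⁾(E^{(−p)}/ℚ) = 4 · #N_p`, the torsion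
classes `κ(T₁) = (p²(e₁-e₂)(e₁-e₃), -p(e₁-e₂))`, `κ(T₂) = (-p(e₂-e₁), p²(e₂-e₁)(e₂-e₃))` having `p`-parities
`(0,1)`, `(1,0)` when the root differences are `p`-units. [cite: SilvermanAEC2009, Prop. X.1.4, Thm. X.4.2] -/
theorem natCard_selmerGroup_twist_eq_four_mul
    (hgp : padicValRat p (e₁ - e₂) = 0 ∧ padicValRat p (e₁ - e₃) = 0 ∧ padicValRat p (e₂ - e₃) = 0)
    [(E.quadraticTwist (-(p : ℚ))).IsElliptic] :
    Nat.card (selmerGroup (E.quadraticTwist (-(p : ℚ))) 2) =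
      4 * Nat.card {c : galH1Torsion (E.quadraticTwist (-(p : ℚ))) 2 //
        c ∈ selmerGroup (E.quadraticTwist (-(p : ℚ))) 2 ∧
        parityHom p (kummerEquiv ℚ 2 ((E.quadraticTwist (-(p : ℚ))).twoTorsionCharH1 (h.quadraticTwist (-(p : ℚ))) c)) = 0 ∧
        parityHom p (kummerEquiv ℚ 2 ((E.quadraticTwist (-(p : ℚ))).twoTorsionCharH1
          (h.quadraticTwist (-(p : ℚ))).swap₁₂ c)) = 0} := by
  have h' := h.quadraticTwist (-(p : ℚ))
  obtain ⟨h12, h13, h23⟩ := hgp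
  have hd0 : (-(p : ℚ)) ≠ 0 := neg_ne_zero.mpr (by exact_mod_cast hp.out.ne_zero)
  have hvd : padicValRat p (-(p : ℚ)) = 1 := by rw [padicValRat.neg, padicValRat.self hp.out.one_lt]
  have he12 : e₁ - e₂ ≠ 0 := sub_ne_zero.mpr h.ne₁₂
  have he21 : e₂ - e₁ ≠ 0 := sub_ne_zero.mpr h.ne₁₂.symm
  have he13 : e₁ - e₃ ≠ 0 := sub_ne_zero.mpr h.ne₁₃
  have he23 : e₂ - e₃ ≠ 0 := sub_ne_zero.mpr h.ne₂₃
  have h21 : padicValRat p (e₂ - e₁) = 0 := by rw [← neg_sub, padicValRat.neg, h12]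
  -- parities of `d² u` and `d u` for a `p`-unit `u`
  have hp2 : ∀ {t : ℚ} (ht : t ≠ 0), padicValRat p t = 0 → parityBit p ((-(p : ℚ)) ^ 2 * t) = 0 := by
    intro t ht h0
    rw [parityBit, padicValRat.mul (pow_ne_zero 2 hd0) ht, padicValRat.pow (-(p : ℚ)), hvd, h0]; decide
  have hp1 : ∀ {t : ℚ} (ht : t ≠ 0), padicValRat p t = 0 → parityBit p ((-(p : ℚ)) * t) = 1 := by
    intro t ht h0
    rw [parityBit, padicValRat.mul hd0 ht, hvd, h0]; decide
  -- the torsion classes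
  have hT1a : (-(p : ℚ) * e₁ - -(p : ℚ) * e₂) * (-(p : ℚ) * e₁ - -(p : ℚ) * e₃) = (-(p : ℚ)) ^ 2 * ((e₁ - e₂) * (e₁ - e₃)) := by ring
  have hT1b : -(p : ℚ) * e₁ - -(p : ℚ) * e₂ = (-(p : ℚ)) * (e₁ - e₂) := by ring
  have hT2a : -(p : ℚ) * e₂ - -(p : ℚ) * e₁ = (-(p : ℚ)) * (e₂ - e₁) := by ring
  have hT2b : (-(p : ℚ) * e₂ - -(p : ℚ) * e₁) * (-(p : ℚ) * e₂ - -(p : ℚ) * e₃) = (-(p : ℚ)) ^ 2 * ((e₂ - e₁) * (e₂ - e₃)) := by ring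
  have hv1a : (-(p : ℚ) * e₁ - -(p : ℚ) * e₂) * (-(p : ℚ) * e₁ - -(p : ℚ) * e₃) ≠ 0 := by
    rw [hT1a]; exact mul_ne_zero (pow_ne_zero 2 hd0) (mul_ne_zero he12 he13)
  have hv1b : -(p : ℚ) * e₁ - -(p : ℚ) * e₂ ≠ 0 := by rw [hT1b]; exact mul_ne_zero hd0 he12
  have hv2a : -(p : ℚ) * e₂ - -(p : ℚ) * e₁ ≠ 0 := by rw [hT2a]; exact mul_ne_zero hd0 he21
  have hv2b : (-(p : ℚ) * e₂ - -(p : ℚ) * e₁) * (-(p : ℚ) * e₂ - -(p : ℚ) * e₃) ≠ 0 := by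
    rw [hT2b]; exact mul_ne_zero (pow_ne_zero 2 hd0) (mul_ne_zero he21 he23)
  refine (E.quadraticTwist (-(p : ℚ))).natCard_selmerGroup_eq_four_mul h' p
    (twoDescentClass_mem_selmerGroup_T₁ _ h' (Units.mk0 _ hv1a) (Units.mk0 _ hv1b) rfl rfl)
    (twoDescentClass_mem_selmerGroup_T₂ _ h' (Units.mk0 _ hv2a) (Units.mk0 _ hv2b) rfl rfl)
    (Units.mk0 _ hv1a) (Units.mk0 _ hv1b) (Units.mk0 _ hv2a) (Units.mk0 _ hv2b)
    ((E.quadraticTwist (-(p : ℚ))).kummerEquiv_twoTorsionCharH1_twoDescentClass h' _ _)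
    ((E.quadraticTwist (-(p : ℚ))).kummerEquiv_twoTorsionCharH1_swap_twoDescentClass h' _ _)
    ((E.quadraticTwist (-(p : ℚ))).kummerEquiv_twoTorsionCharH1_twoDescentClass h' _ _)
    ((E.quadraticTwist (-(p : ℚ))).kummerEquiv_twoTorsionCharH1_swap_twoDescentClass h' _ _) ⟨?_, ?_⟩ ⟨?_, ?_⟩
  · rw [Units.val_mk0, hT1a]; exact hp2 (mul_ne_zero he12 he13) (by rw [padicValRat.mul he12 he13, h12, h13, add_zero])
  · rw [Units.val_mk0, hT1b]; exact hp1 he12 h12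
  · rw [Units.val_mk0, hT2a]; exact hp1 he21 h21
  · rw [Units.val_mk0, hT2b]; exact hp2 (mul_ne_zero he21 he23) (by rw [padicValRat.mul he21 he23, h21, h23, add_zero])

/-- **`#Sel⁽²⁾(E₀^{(−p₀)}/ℚ) = 8`** — D0≤2 at `Q₀ = ∅` for the rank-one genus twist. For `E/ℚ` with rational
`2`-torsion `e₁ < e₂`, `e₁ < e₃`, rank `0`, `Ш(E)[2] = 0`; `S ∋ 2` a finite set of primes with the root differences
units and `E` of good reduction off `S`; `p ∉ S` a prime, `p ≡ 7 (mod 8)`, `(−p/ℓ) = 1` for all odd `ℓ ∈ S`: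
`#Sel⁽²⁾(E^{(−p)}/ℚ) = 8`. [cite: SilvermanAEC2009, Prop. X.1.4, Thm. X.4.2, Prop. X.4.9] [cite: Kramer1981, Thm. 1] -/
theorem natCard_selmerGroup_twist_negPrime_eq_eight (h : E.toAffine.SplitTwoTorsion e₁ e₂ e₃) (hS : ∀ q ∈ S, q.Prime) (h2S : 2 ∈ S) (h12 : e₁ < e₂) (h13 : e₁ < e₃)
    (hgood : ∀ ℓ : ℕ, (hℓ : ℓ.Prime) → ℓ ∉ S → haveI : Fact ℓ.Prime := ⟨hℓ⟩;
      padicValRat ℓ (e₁ - e₂) = 0 ∧ padicValRat ℓ (e₁ - e₃) = 0 ∧ padicValRat ℓ (e₂ - e₃) = 0)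
    (hN : ∀ ℓ : ℕ, ℓ.Prime → ℓ ∉ S → ¬ ℓ ∣ E.conductorNorm ℤ)
    (hrank : E.mordellWeilRank = 0) (hsha : ∀ x ∈ E.sha, (2 : ℕ) • x = 0 → x = 0)
    (hpS : p ∉ S) (hp8 : p % 8 = 7)
    (hsplit : ∀ ℓ ∈ S, (hℓ : ℓ.Prime) → ℓ ≠ 2 → haveI : Fact ℓ.Prime := ⟨hℓ⟩; legendreSym ℓ (-(p : ℤ)) = 1)
    [(E.quadraticTwist (-(p : ℚ))).IsElliptic] :
    Nat.card (selmerGroup (E.quadraticTwist (-(p : ℚ))) 2) = 8 := by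
  have h' := h.quadraticTwist (-(p : ℚ))
  haveI : Finite (selmerGroup (E.quadraticTwist (-(p : ℚ))) 2) :=
    (E.quadraticTwist (-(p : ℚ))).finite_selmerGroup_holds two_ne_zero
  haveI : Finite (E.selmerGroup 2) := E.finite_selmerGroup_holds two_ne_zero
  rw [natCard_selmerGroup_twist_eq_four_mul E h (hgood p hp.out hpS)]
  -- the two finite sets `N` (p-unramified twisted classes) and `S₊` (positive base classes)
  set N := {c : galH1Torsion (E.quadraticTwist (-(p : ℚ))) 2 //
        c ∈ selmerGroup (E.quadraticTwist (-(p : ℚ))) 2 ∧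
        parityHom p (kummerEquiv ℚ 2 ((E.quadraticTwist (-(p : ℚ))).twoTorsionCharH1 h' c)) = 0 ∧
        parityHom p (kummerEquiv ℚ 2 ((E.quadraticTwist (-(p : ℚ))).twoTorsionCharH1 h'.swap₁₂ c)) = 0} with hNdef
  set P := {c : galH1Torsion E 2 // c ∈ E.selmerGroup 2 ∧ signHom (kummerEquiv ℚ 2 (E.twoTorsionCharH1 h.swap₁₂ c)) = 0}
    with hPdef
  have hP : Nat.card P = 2 := E.natCard_selmer_signBit_eq_zero_eq_two h h12 hrank hsha
  suffices hNP : Nat.card N = Nat.card P by rw [hNP, hP]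
  haveI : Finite N := Finite.of_injective (fun x : N => (⟨x.1, x.2.1⟩ : selmerGroup (E.quadraticTwist (-(p : ℚ))) 2))
    (fun x y hxy => Subtype.ext (by simpa using congrArg Subtype.val hxy))
  haveI : Finite P := Finite.of_injective (fun x : P => (⟨x.1, x.2.1⟩ : E.selmerGroup 2))
    (fun x y hxy => Subtype.ext (by simpa using congrArg Subtype.val hxy))
  -- representatives
  have repN : ∀ c : galH1Torsion (E.quadraticTwist (-(p : ℚ))) 2, ∃ ab : ℚˣ × ℚˣ,
      kummerEquiv ℚ 2 ((E.quadraticTwist (-(p : ℚ))).twoTorsionCharH1 h' c) = Additive.ofMul (QuotientGroup.mk ab.1) ∧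
      kummerEquiv ℚ 2 ((E.quadraticTwist (-(p : ℚ))).twoTorsionCharH1 h'.swap₁₂ c) = Additive.ofMul (QuotientGroup.mk ab.2) :=
    fun c => by
      obtain ⟨a, b, ha, hb⟩ := (E.quadraticTwist (-(p : ℚ))).exists_kummerEquiv_twoTorsionCharH1_pair_eq h' c
      exact ⟨(a, b), ha, hb⟩
  choose ρ hρ using repN
  have repP : ∀ c : galH1Torsion E 2, ∃ ab : ℚˣ × ℚˣ,
      kummerEquiv ℚ 2 (E.twoTorsionCharH1 h c) = Additive.ofMul (QuotientGroup.mk ab.1) ∧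
      kummerEquiv ℚ 2 (E.twoTorsionCharH1 h.swap₁₂ c) = Additive.ofMul (QuotientGroup.mk ab.2) :=
    fun c => by
      obtain ⟨a, b, ha, hb⟩ := E.exists_kummerEquiv_twoTorsionCharH1_pair_eq h c
      exact ⟨(a, b), ha, hb⟩
  choose σ hσ using repP
  -- `N → P`
  have keyN : ∀ x : N, 0 < ((ρ x.1).1 : ℚ) ∧ 0 < ((ρ x.1).2 : ℚ) ∧ E.twoDescentClass h (ρ x.1).1 (ρ x.1).2 ∈ E.selmerGroup 2 := by
    intro x
    refine pos_and_mem_selmerGroup_of_twist E h S hS h2S hgood hN hpS hp8 hsplit x.2.1 _ _ (hρ x.1).1 (hρ x.1).2 ?_ ?_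
    · rw [← (E.quadraticTwist (-(p : ℚ))).parityHom_kummerEquiv_eq_parityBit h' p (hρ x.1).1]; exact x.2.2.1
    · rw [← (E.quadraticTwist (-(p : ℚ))).parityHom_kummerEquiv_eq_parityBit h'.swap₁₂ p (hρ x.1).2]; exact x.2.2.2
  let f : N → P := fun x => ⟨E.twoDescentClass h (ρ x.1).1 (ρ x.1).2, (keyN x).2.2, by
    rw [E.signHom_kummerEquiv_eq_signBit h (E.kummerEquiv_twoTorsionCharH1_swap_twoDescentClass h _ _)]
    exact (signBit_eq_zero_iff (ρ x.1).2.ne_zero).mpr (keyN x).2.1⟩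
  have hf : Function.Injective f := by
    intro x y hxy
    have hcl : E.twoDescentClass h (ρ x.1).1 (ρ x.1).2 = E.twoDescentClass h (ρ y.1).1 (ρ y.1).2 := congrArg Subtype.val hxy
    have ha : (QuotientGroup.mk (ρ x.1).1 : SqUnits ℚ) = QuotientGroup.mk (ρ y.1).1 := by
      have h1 := E.kummerEquiv_twoTorsionCharH1_twoDescentClass h (ρ x.1).1 (ρ x.1).2
      rw [hcl, E.kummerEquiv_twoTorsionCharH1_twoDescentClass h] at h1
      exact (Additive.ofMul.injective h1).symm
    have hb : (QuotientGroup.mk (ρ x.1).2 : SqUnits ℚ) = QuotientGroup.mk (ρ y.1).2 := by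
      have h1 := E.kummerEquiv_twoTorsionCharH1_swap_twoDescentClass h (ρ x.1).1 (ρ x.1).2
      rw [hcl, E.kummerEquiv_twoTorsionCharH1_swap_twoDescentClass h] at h1
      exact (Additive.ofMul.injective h1).symm
    apply Subtype.ext
    exact (E.quadraticTwist (-(p : ℚ))).eq_of_kummerEquiv_twoTorsionCharH1_pair_eq h' (ρ y.1).1 (ρ y.1).2
      (by rw [(hρ x.1).1, ha]) (by rw [(hρ x.1).2, hb]) (hρ y.1).1 (hρ y.1).2
  -- `P → N`
  have keyP : ∀ y : P, 0 < ((σ y.1).1 : ℚ) ∧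
      (E.quadraticTwist (-(p : ℚ))).twoDescentClass h' (σ y.1).1 (σ y.1).2 ∈ selmerGroup (E.quadraticTwist (-(p : ℚ))) 2 ∧
      parityBit p ((σ y.1).1 : ℚ) = 0 ∧ parityBit p ((σ y.1).2 : ℚ) = 0 := by
    intro y
    refine mem_selmerGroup_twist_of_pos E h S hS h2S h12 h13 hgood hN hpS hp8 hsplit y.2.1 _ _ (hσ y.1).1 (hσ y.1).2 ?_
    have := y.2.2
    rw [E.signHom_kummerEquiv_eq_signBit h (hσ y.1).2] at this
    exact (signBit_eq_zero_iff (σ y.1).2.ne_zero).mp this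
  let g : P → N := fun y => ⟨(E.quadraticTwist (-(p : ℚ))).twoDescentClass h' (σ y.1).1 (σ y.1).2, (keyP y).2.1, by
    rw [(E.quadraticTwist (-(p : ℚ))).parityHom_kummerEquiv_eq_parityBit h' p
      ((E.quadraticTwist (-(p : ℚ))).kummerEquiv_twoTorsionCharH1_twoDescentClass h' _ _)]
    exact (keyP y).2.2.1, by
    rw [(E.quadraticTwist (-(p : ℚ))).parityHom_kummerEquiv_eq_parityBit h'.swap₁₂ p
      ((E.quadraticTwist (-(p : ℚ))).kummerEquiv_twoTorsionCharH1_swap_twoDescentClass h' _ _)]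
    exact (keyP y).2.2.2⟩
  have hg : Function.Injective g := by
    intro x y hxy
    have hcl : (E.quadraticTwist (-(p : ℚ))).twoDescentClass h' (σ x.1).1 (σ x.1).2 =
        (E.quadraticTwist (-(p : ℚ))).twoDescentClass h' (σ y.1).1 (σ y.1).2 := congrArg Subtype.val hxy
    have ha : (QuotientGroup.mk (σ x.1).1 : SqUnits ℚ) = QuotientGroup.mk (σ y.1).1 := by
      have h1 := (E.quadraticTwist (-(p : ℚ))).kummerEquiv_twoTorsionCharH1_twoDescentClass h' (σ x.1).1 (σ x.1).2
      rw [hcl, (E.quadraticTwist (-(p : ℚ))).kummerEquiv_twoTorsionCharH1_twoDescentClass h'] at h1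
      exact (Additive.ofMul.injective h1).symm
    have hb : (QuotientGroup.mk (σ x.1).2 : SqUnits ℚ) = QuotientGroup.mk (σ y.1).2 := by
      have h1 := (E.quadraticTwist (-(p : ℚ))).kummerEquiv_twoTorsionCharH1_swap_twoDescentClass h' (σ x.1).1 (σ x.1).2
      rw [hcl, (E.quadraticTwist (-(p : ℚ))).kummerEquiv_twoTorsionCharH1_swap_twoDescentClass h'] at h1
      exact (Additive.ofMul.injective h1).symm
    apply Subtype.ext
    exact E.eq_of_kummerEquiv_twoTorsionCharH1_pair_eq h (σ y.1).1 (σ y.1).2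
      (by rw [(hσ x.1).1, ha]) (by rw [(hσ x.1).2, hb]) (hσ y.1).1 (hσ y.1).2
  exact le_antisymm (Nat.card_le_card_of_injective f hf) (Nat.card_le_card_of_injective g hg)

end Summit.BirchSwinnertonDyer.BirchSwinnertonDyer.Theorems.GenusKolyvaginAtTwo.TorsionCellD0

end
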